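import Literature.MathematicalPhysics.QuantumFieldTheory.Balaban1983to89.BlockAveragingPlaquetteBound
import Literature.MathematicalPhysics.QuantumFieldTheory.Balaban1983to89.T3LowerAlongMinimisersSplit
import HarnessLib

/-!
# `Balaban1983to89.T3OneStepAveragingPlaquettes` — rung R3, crux K1, child «MinimiserStabilityRegPr» (stmt-QuantumFields-19200), stub LOWER:
# THE PLAQUETTE CLAUSE OF THE AVERAGED MINIMISER, PROVED — the schema `Prop1EmlAt` ([Balaban1985Averaging] Prop 1 for (0.4), asserted in print)
# REPLACED by the tree's crude Prop 1 for (0.4) (`BlockAveragingPlaquetteBound`, proved), and the LOWER composition re-derived without it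

Cell `ym3-torus` (HUMAN RULING D-0037, YM ladder rung R3), seat `ym3-torus-p1` gen 6 (UV side); cell record HOME/UV3-NODE.md §15.  WHAT THIS IS
NOT: no estimate beyond the crude one-step plaquette bound; LOWER still rests on the schemas `MinimisersIn8At` ([Balaban1985Variational] Prop 8,
PRINTED), `AvgDivSmallAt` (G-K1a-3a, located) and `AvgActionIneqAt` (G-K1a-3b, located) of `T3LowerAlongMinimisersSplit`.

* §1 `descendTo_succ`: one descent step of the family is one (0.4) block averaging followed by the level identification `fieldShift`;
  **`plaqSmall_descendTo_succ`**: `PlaqSmall a U ⇒ PlaqSmall ((L² + 6(5L)²)·a) (D_{K,K+1}U)` for `0 ≤ a`, `((5L)²/4)·a < δ₂ = min(1/3, π/2)`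
  (d = 3, `G = SU(2)`: `BlockAveragingPlaquetteBound.plaqSmall_blockAvg_expMeanLogSU` through `T3CruxEstimates.plaqSmall_fieldShift`).
* §2 **`plaqSmall_descendTo_of_mem8'`** (the PROVED twin of `T3LowerAlongMinimisersSplit.plaqSmall_descendTo_of_mem8`, no `Prop1EmlAt`):
  `U′ ∈ (8)_{K+1}` (radius `B₃ε₁`) ⇒ the average has plaquettes `< ε₀L^{−2(K−n)}` once `151·B₃ε₁ ≤ ε₀` and `(25L²/4)·B₃ε₁ < δ₂`;
  **`descendTo_mem_regFibrePr'`**; **`lowerAlongRegPrMinimisersAt_of_split'`**: `MinimisersIn8At ∧ AvgDivSmallAt` (constants `a₀ a₁ B₃ > 0`) ⇒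
  `∃ ε₁′ > 0, ∀ ε₀ ∈ (0, ε₁′], ∀ m ≥ 2, ∀ b₀ > 0, ∀ p₀, ∃ γ₁ > 0, ∀ F γ, F.L = L → 0 < γ ≤ γ₁ →
  AvgActionIneqAt F γ b₀ p₀ m ε₀ B₃ → LowerAlongRegPrMinimisersAt F γ b₀ p₀ m ε₀` — LOWER = Prop 8 (PRINTED) ∧ G-K1a-3a ∧ G-K1a-3b, the
  [Balaban1985Averaging]-Prop-1-for-(0.4) input DISCHARGED by the tree.

References: T. Bałaban, CMP 98 (1985) 17–51 [Balaban1985Averaging] (Prop 1 (51) p.26); CMP 109 (1987) 249–301 [Balaban1987RG1] ((0.4), (0.11)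
p.253); CMP 102 (1985) 277–309 [Balaban1985Variational] (Prop 8 p.304); P. Federbush, CMP 110 (1987) 293–309 [Federbush1987PhaseCellIII].
-/

noncomputable section

open MeasureTheory Filter Topology
open Literature.MathematicalPhysics.QuantumFieldTheory.Balaban1983to89.T3ContinuumYM3Torus
open Literature.MathematicalPhysics.QuantumFieldTheory.Balaban1983to89.T3LevelShift
open Literature.MathematicalPhysics.QuantumFieldTheory.Balaban1983to89.T3UnitLawDensityEML (ℰp measurableE_ℰp)
open Literature.MathematicalPhysics.QuantumFieldTheory.Balaban1983to89.T3UnitScaleTilt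
open Literature.MathematicalPhysics.QuantumFieldTheory.Balaban1983to89.T3TiltDescent
open Literature.MathematicalPhysics.QuantumFieldTheory.Balaban1983to89.T3CruxEstimates
open Literature.MathematicalPhysics.QuantumFieldTheory.Balaban1983to89.T3ConstrainedMinimiser
open Literature.MathematicalPhysics.QuantumFieldTheory.Balaban1983to89.T3DescentFibreTower
open Literature.MathematicalPhysics.QuantumFieldTheory.Balaban1983to89.T3MinimiserStabilityReduction
open Literature.MathematicalPhysics.QuantumFieldTheory.Balaban1983to89.T3RegularMinimiser
open Literature.MathematicalPhysics.QuantumFieldTheory.Balaban1983to89.T3PrintedRegularMinimiser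
open Literature.MathematicalPhysics.QuantumFieldTheory.Balaban1983to89.T3PrintedRegularMinimiserReduction
open Literature.MathematicalPhysics.QuantumFieldTheory.Balaban1983to89.T3ThresholdSmallness (exists_forall_θBal_le)
open Literature.MathematicalPhysics.QuantumFieldTheory.Balaban1983to89.T3LowerAlongMinimisersSplit
open Literature.MathematicalPhysics.QuantumFieldTheory.Balaban1983to89.BlockAveragingPlaquetteBound
open Literature.MathematicalPhysics.QuantumFieldTheory.Balaban1983to89.ExpMeanLog (deltaSU deltaSU_pos)
open Literature.MathematicalPhysics.QuantumFieldTheory.Balaban1983to89.Missing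

namespace Literature.MathematicalPhysics.QuantumFieldTheory.Balaban1983to89.T3OneStepAveragingPlaquettes

/-! ## §1 One descent step = one (0.4) averaging; its plaquettes -/

section OneStep

variable (F : T3Family) {G : Type*} [GaugeGroup G] (ℰ : LoopAverage G)

/-- Reindexing an iterated averaging along a propositional equality of the number of steps (local copy of the `T3TiltDescent` helper).
[folklore] -/
private theorem fieldShift_iter_of_eq {K a b : ℕ} (hab : a = b) (U : GaugeField (F.PP F.m K) 0 G) :
    fieldShift (F.sitesPerDir_eq (m := F.m) (K := K) (j := a) (m' := F.m) (K' := K) (j' := b) (by omega))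
        (Averaging.iter (fun i => BlockAveraging.blockAvg (P := F.PP F.m K) (j := i) ℰ) b U) =
      Averaging.iter (fun i => BlockAveraging.blockAvg (P := F.PP F.m K) (j := i) ℰ) a U := by
  subst hab
  exact fieldShift_refl _ _

/-- **ONE DESCENT STEP IS ONE (0.4) AVERAGING**: `D_{K,K+1}U` is the block average of `U` read on the finest lattice of the `K`-th approximation.
[cite: Balaban1987RG1, (0.11) p.253] -/
theorem descendTo_succ (K : ℕ) (U : GaugeField (F.P (K + 1)) 0 G) :
    descendTo F ℰ K (K + 1) (Nat.le_succ K) U =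
      fieldShift (F.sitesPerDir_eq (m := F.m) (K := K) (j := 0) (m' := F.m) (K' := K + 1) (j' := 1) (by omega))
        ((BlockAveraging.blockAvg (P := F.PP F.m (K + 1)) (j := 0) ℰ).avg U) := by
  show fieldShift _ (Averaging.iter (fun i => BlockAveraging.blockAvg (P := F.PP F.m (K + 1)) (j := i) ℰ) (K + 1 - K) U) = _
  rw [← fieldShift_iter_of_eq F ℰ (show K + 1 - K = 1 by omega) U, fieldShift_fieldShift]
  rfl

/-- **THE PLAQUETTES OF ONE DESCENT STEP OF A SMALL FIELD** (d = 3, `G = SU(2)`, the family's averaging `ℰp`): `PlaqSmall a U`, `0 ≤ a`,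
`((5L)²/4)·a < δ₂` ⇒ `PlaqSmall ((L² + 6(5L)²)·a) (D_{K,K+1}U)`. [cite: Balaban1985Averaging, Prop. 1 (51) p.26] -/
theorem plaqSmall_descendTo_succ (K : ℕ) {a : ℝ} (ha : 0 ≤ a) {U : GaugeField (F.P (K + 1)) 0 (Matrix.specialUnitaryGroup (Fin 2) ℂ)}
    (hU : PlaqSmall a U) (ht : ((((3 + 2) * F.L : ℕ) : ℝ) ^ 2 / 4) * a < deltaSU (Fin 2)) :
    PlaqSmall (((F.L : ℝ) ^ 2 + 6 * (((3 + 2) * F.L : ℕ) : ℝ) ^ 2) * a) (descendTo F ℰp K (K + 1) (Nat.le_succ K) U) := by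
  rw [descendTo_succ]
  refine (plaqSmall_fieldShift F _ _ _).mpr ?_
  have hj : 0 + 1 ≤ (F.P (K + 1)).m + (F.P (K + 1)).K := by show 0 + 1 ≤ F.m + (K + 1); omega
  exact plaqSmall_blockAvg_expMeanLogSU (P := F.P (K + 1)) (n := Fin 2) hj ha hU ht

end OneStep

/-! ## §2 LOWER's admissibility without the [Balaban1985Averaging]-Prop-1 schema -/

section Lower

variable (F : T3Family)

/-- **PLAQUETTE CLAUSE OF THE AVERAGED MINIMISER, PROVED**: if `U′ ∈ (8)_{K+1}` (plaquettes `< B₃ε₁L^{−2(K+1−n)}`), `0 < B₃ε₁`,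
`151·B₃ε₁ ≤ ε₀` and `(25L²/4)·B₃ε₁ < δ₂`, then the one-step average has plaquettes `< ε₀L^{−2(K−n)}`. [cite: Balaban1985Averaging, Prop. 1 (51) p.26] -/
theorem plaqSmall_descendTo_of_mem8' {n K : ℕ} (hnK : n ≤ K) {B₃ ε₁ ε₀ : ℝ} (hBε : 0 < B₃ * ε₁) (h151 : 151 * (B₃ * ε₁) ≤ ε₀)
    (hδ : (25 * (F.L : ℝ) ^ 2 / 4) * (B₃ * ε₁) < deltaSU (Fin 2)) {V : GaugeField (F.P n) 0 (Matrix.specialUnitaryGroup (Fin 2) ℂ)}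
    {U' : GaugeField (F.P (K + 1)) 0 (Matrix.specialUnitaryGroup (Fin 2) ℂ)}
    (hU' : U' ∈ regFibrePr F n (K + 1) (hnK.trans (Nat.le_succ K)) (B₃ * ε₁) V) :
    PlaqSmall (regThreshold F n K ε₀) (descendTo F ℰp K (K + 1) (Nat.le_succ K) U') := by
  set a := regThreshold F n (K + 1) (B₃ * ε₁) with ha_def
  obtain ⟨hs, hs1⟩ := scale_pos_le_one F (2 * (K + 1 - n))
  have ha : 0 < a := mul_pos hBε hs
  have ha_le : a ≤ B₃ * ε₁ := mul_le_of_le_one_right hBε.le hs1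
  have hL : (0 : ℝ) < F.L := L_cast_pos F
  have hcast : (((3 + 2) * F.L : ℕ) : ℝ) = 5 * F.L := by push_cast; ring
  -- the guard
  have ht : ((((3 + 2) * F.L : ℕ) : ℝ) ^ 2 / 4) * a < deltaSU (Fin 2) := by
    rw [hcast]
    have : ((5 * (F.L : ℝ)) ^ 2 / 4) * a ≤ (25 * (F.L : ℝ) ^ 2 / 4) * (B₃ * ε₁) := by
      rw [show (5 * (F.L : ℝ)) ^ 2 / 4 = 25 * (F.L : ℝ) ^ 2 / 4 by ring]
      exact mul_le_mul_of_nonneg_left ha_le (by positivity)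
    exact this.trans_lt hδ
  have havg := plaqSmall_descendTo_succ F K ha.le hU'.1.2 ht
  refine fun p => (havg p).trans_le ?_
  -- `(L² + 150L²)·B₃ε₁L^{−2(K+1−n)} = 151·B₃ε₁·L^{−2(K−n)} ≤ ε₀L^{−2(K−n)}`
  rw [hcast, show ((F.L : ℝ) ^ 2 + 6 * (5 * (F.L : ℝ)) ^ 2) * a = 151 * ((F.L : ℝ) ^ 2 * a) by ring, ha_def,
    sq_mul_regThreshold_succ F hnK]
  unfold regThreshold
  obtain ⟨ht0, _⟩ := scale_pos_le_one F (2 * (K - n))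
  nlinarith

/-- **THE COMPETITOR IS ADMISSIBLE** (PROVED plaquette clause; divergence clause from `AvgDivSmallAt`): the one-step average of a minimiser in
(8)_{K+1} lies in print's regular fibre (6) of run `K`. [cite: Balaban1985Variational, (6) p.278] -/
theorem descendTo_mem_regFibrePr' {L : ℕ} {a₀ a₁ B₃ : ℝ} (hB₃ : 0 < B₃) (hdiv : AvgDivSmallAt L a₀ a₁ B₃) (hF : F.L = L) {n K : ℕ}
    (hnK : n < K) {ε₁ ε₀ : ℝ} (hε₁ : 0 < ε₁) (hε₁a : ε₁ ≤ a₁) (hlo : B₃ * ε₁ ≤ ε₀) (hhi : ε₀ ≤ a₀) (h151 : 151 * (B₃ * ε₁) ≤ ε₀)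
    (hδ : (25 * (F.L : ℝ) ^ 2 / 4) * (B₃ * ε₁) < deltaSU (Fin 2))
    {V : GaugeField (F.P n) 0 (Matrix.specialUnitaryGroup (Fin 2) ℂ)} (hV : PlaqSmall ε₁ V)
    {U' : GaugeField (F.P (K + 1)) 0 (Matrix.specialUnitaryGroup (Fin 2) ℂ)}
    (hU'8 : U' ∈ regFibrePr F n (K + 1) (hnK.le.trans (Nat.le_succ K)) (B₃ * ε₁) V)
    (hmin : IsMinOn (fun W : GaugeField (F.P (K + 1)) 0 (Matrix.specialUnitaryGroup (Fin 2) ℂ) => wilsonAction4 W)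
      (regFibrePr F n (K + 1) (hnK.le.trans (Nat.le_succ K)) ε₀ V) U') :
    descendTo F ℰp K (K + 1) (Nat.le_succ K) U' ∈ regFibrePr F n K hnK.le ε₀ V :=
  ⟨⟨descendTo_mem_fibre F ℰp hnK.le (Nat.le_succ K) hU'8.1.1,
      plaqSmall_descendTo_of_mem8' F hnK.le (mul_pos hB₃ hε₁) h151 hδ hU'8⟩,
    hdiv F hF n K hnK ε₁ ε₀ hε₁ hε₁a hlo hhi V hV U' hU'8 hmin⟩

/-- **LOWER ⇐ PROP 8 ∧ G-K1a-3a → (G-K1a-3b → stub), UNDER THE ROUTE'S PREFIX — the [Balaban1985Averaging]-Prop-1 input DISCHARGED.**  As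
`T3LowerAlongMinimisersSplit.lowerAlongRegPrMinimisersAt_of_split` without `Prop1EmlAt`: the thresholds now also ask `151·B₃θ ≤ ε₀` and
`(25L²/4)·B₃θ < δ₂` at every height, which `exists_forall_θBal_le` provides. [cite: Balaban1985Variational, Prop 8 p.304; Federbush1987PhaseCellIII, Thm 4.3 p.299] -/
theorem lowerAlongRegPrMinimisersAt_of_split' {L : ℕ} {a₀ a₁ B₃ : ℝ} (ha₀ : 0 < a₀) (ha₁ : 0 < a₁) (hB₃ : 0 < B₃)
    (h8 : MinimisersIn8At L a₀ a₁ B₃) (hdiv : AvgDivSmallAt L a₀ a₁ B₃) :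
    ∃ ε₁' : ℝ, 0 < ε₁' ∧ ∀ ε₀ : ℝ, 0 < ε₀ → ε₀ ≤ ε₁' → ∀ m : ℕ, 2 ≤ m → ∀ b₀ p₀ : ℝ, 0 < b₀ →
      ∃ γ₁ : ℝ, 0 < γ₁ ∧ ∀ (F : T3Family) (γ : ℝ), F.L = L → 0 < γ → γ ≤ γ₁ →
        AvgActionIneqAt F γ b₀ p₀ m ε₀ B₃ → LowerAlongRegPrMinimisersAt F γ b₀ p₀ m ε₀ := by
  refine ⟨a₀, ha₀, fun ε₀ hε₀ hε₀a m hm b₀ p₀ hb => ?_⟩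
  by_cases hL : 1 ≤ L
  · have hδ2 : 0 < deltaSU (Fin 2) := deltaSU_pos
    set σ : ℝ := min a₁ (min (ε₀ / (151 * B₃)) (deltaSU (Fin 2) / (2 * (25 * (L : ℝ) ^ 2 / 4) * B₃))) with hσ_def
    have hL0 : (0 : ℝ) < L := by exact_mod_cast hL
    have hσ : 0 < σ := lt_min ha₁ (lt_min (by positivity) (by positivity))
    obtain ⟨γ₁, hγ₁, hθ⟩ := exists_forall_θBal_le hL b₀ p₀ hσ
    refine ⟨min γ₁ 1, lt_min hγ₁ one_pos, fun F γ hF hγ hγle hineq => ?_⟩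
    have hγ₁' : γ ≤ γ₁ := hγle.trans (min_le_left _ _)
    have hγ1 : γ ≤ 1 := hγle.trans (min_le_right _ _)
    obtain ⟨K₀, r, hr, hr0, hineq⟩ := hineq
    refine ⟨max K₀ 1, r, hr, hr0, fun K hK V hV U' hU' hU'min => ?_⟩
    have hK₀ : K₀ ≤ K := (le_max_left _ _).trans hK
    have hK1 : 1 ≤ K := (le_max_right _ _).trans hK
    have hnK : K / m < K := Nat.div_lt_self (by omega) (by omega)
    have hnK' : K / m < K + 1 := hnK.trans (Nat.lt_succ_self K)
    have hFL : 1 ≤ F.L := F.hL.2.le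
    set ε₁ := θBal F.L γ b₀ p₀ (K / m) with hε₁_def
    have hε₁ : 0 < ε₁ := θBal_pos hFL hγ hγ1 hb p₀ (K / m)
    have hθσ : ε₁ ≤ σ := by rw [hε₁_def, hF]; exact hθ γ hγ hγ₁' (K / m)
    have hε₁a : ε₁ ≤ a₁ := hθσ.trans (min_le_left _ _)
    have hε₂ : ε₁ ≤ ε₀ / (151 * B₃) := hθσ.trans ((min_le_right _ _).trans (min_le_left _ _))
    have hε₃ : ε₁ ≤ deltaSU (Fin 2) / (2 * (25 * (L : ℝ) ^ 2 / 4) * B₃) := hθσ.trans ((min_le_right _ _).trans (min_le_right _ _))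
    have h151 : 151 * (B₃ * ε₁) ≤ ε₀ := by
      have h := mul_le_mul_of_nonneg_left hε₂ (by positivity : (0 : ℝ) ≤ 151 * B₃)
      rwa [mul_div_cancel₀ _ (by positivity : (151 : ℝ) * B₃ ≠ 0), show 151 * B₃ * ε₁ = 151 * (B₃ * ε₁) by ring] at h
    have hlo : B₃ * ε₁ ≤ ε₀ := by nlinarith [mul_pos hB₃ hε₁]
    have hδ : (25 * (F.L : ℝ) ^ 2 / 4) * (B₃ * ε₁) < deltaSU (Fin 2) := by
      rw [hF]
      have hpos : (0 : ℝ) < 2 * (25 * (L : ℝ) ^ 2 / 4) * B₃ := by positivity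
      have h := mul_le_mul_of_nonneg_left hε₃ hpos.le
      rw [mul_div_cancel₀ _ hpos.ne'] at h
      have h' : (25 * (L : ℝ) ^ 2 / 4) * (B₃ * ε₁) = (2 * (25 * (L : ℝ) ^ 2 / 4) * B₃ * ε₁) / 2 := by ring
      rw [h']
      linarith
    have hmin := isMinOn_of_eq_minActionRegPr F hU'min
    have hU'8 : U' ∈ regFibrePr F (K / m) (K + 1) (hnK'.le) (B₃ * ε₁) V :=
      h8 F hF (K / m) (K + 1) hnK' ε₁ ε₀ hε₁ hε₁a hlo hε₀a V hV U' hU' hmin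
    refine ⟨descendTo F ℰp K (K + 1) (Nat.le_succ K) U', ?_, hineq K hK₀ V hV U' hU'8 hmin⟩
    exact descendTo_mem_regFibrePr' F hB₃ hdiv hF hnK hε₁ hε₁a hlo hε₀a h151 hδ hV hU'8 hmin
  · refine ⟨1, one_pos, fun F γ hF _ _ _ => ?_⟩
    exact absurd (hF ▸ F.hL.2.le) hL

end Lower

end Literature.MathematicalPhysics.QuantumFieldTheory.Balaban1983to89.T3OneStepAveragingPlaquettes

end
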